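import Summits.QuantumFields.YangMills.Theorems.UnitScaleTiltProp7PinnedKernelL1Rows
import Summits.QuantumFields.BalabanUV.T4Continuum.Support.StarCarrierComponentPairing
import HarnessLib

/-!
# Route `UnitScaleTilt`, crux K1 «MinimiserStabilityRegPr» (stmt-QuantumFields-19200), route-R E′ path (α′), residue (hK), assembly (A), file (F-b, part 1 of 2):
# THE SCALE READING OF THE EXPLICIT BOUND — pure real arithmetic: every atomic piece of ✓ `Prop7PinnedKernelL1Explicit.sum_abs_laplace_kernel_le_explicit`'s right-hand
# side at `d = 3`, `ℓ ≥ 3`, `0 < κ ≤ 1∕4` is bounded by an absolute multiple of a monomial in `ℓ`, `√ℓ`, `c⁻²`, and the four summands are each `≤ K·ℓ∕c²`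

Cell `ym3-torus`, width seat `ym3-torus-px22` (gen 2) = the (A)-instantiation seat (★routeR-w3 g5 19:59:56Z).  `--supports stmt-QuantumFields-19200`, count-neutral.  THEOREMS ONLY
(0 `def`, 0 `sorry`).  YM₃ on T³ is a ladder rung (R3), not the Clay problem; nothing here claims the stub, the crux, d = 4 or the gap.

WHAT IS PROVED (ns `…Theorems.Prop7PinnedKernelL1Arith`; all statements over `ℝ`).
* §1 letters: `sqrt_three_le` (`√3 ≤ 9∕5`), `ceil_radius_le`, `card_pow_le` (`(2(⌈10√3ℓ⌉₊+1))³ ≤ (40ℓ)³`), `card_pow_le'` (`(2(⌈10√3ℓ+ℓ⌉₊+1))³ ≤ (42ℓ)³`), `weight_count_le` (`W ≤ √((2+9π∕(10κ))³)·ℓ√ℓ`), `exp_annulus_le`, `exp_annulus_le'` (`Ω ≤ e^{20κ}`, `Ω_u ≤ e^{21κ}`), `sqrtA_eq`, `A_eq`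
  (`√(C_G∕c⁴) = √C_G∕c²`, `√(√(C_G∕c⁴)ℓ²) = √(√C_G)·ℓ∕|c|`).
* §2 the four summand bounds `T1_le`, `N2_le`, `N3_le`, `T4_le` and ★★★ `explicit_le_linear` — the whole right-hand side is `≤ Φ₀(κ, C_R, C_N, C_{H1}, C_H, C_V)·ℓ∕c²` with `Φ₀` explicit.
HONEST SCOPE.  Inequalities between real numbers; no lattice object appears.

References: T. Bałaban, CMP 96 (1984) 223–250 [Balaban1984PropagatorsII] ((2.61) p.234); CMP 99 (1985) 75–102 [Balaban1985RegularSpaces] ((1.36) p.82).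
-/

set_option autoImplicit false

noncomputable section

open scoped BigOperators

namespace Summit.QuantumFields.YangMills.Theorems.Prop7PinnedKernelL1Arith

open Summit.QuantumFields.BalabanUV.T4Continuum.StarCarrierComponentPairing (sqrt_cube)

/-! ## §1 Letters -/

/-- `√3 ≤ 9∕5`. [folklore] -/
theorem sqrt_three_le : Real.sqrt 3 ≤ 9 / 5 := by
  rw [show (9 / 5 : ℝ) = Real.sqrt ((9 / 5) ^ 2) by rw [Real.sqrt_sq (by norm_num)]]
  exact Real.sqrt_le_sqrt (by norm_num)

/-- `⌈10√3·ℓ⌉₊ ≤ 18ℓ + 1` and `⌈10√3ℓ + ℓ⌉₊ ≤ 19ℓ + 1` for `ℓ ≥ 0` (read with `5√3·(2ℓ) = 10√3ℓ`). [folklore] -/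
theorem ceil_radius_le {ℓ : ℝ} (hℓ : 0 ≤ ℓ) :
    (⌈5 * Real.sqrt 3 * (2 * ℓ)⌉₊ : ℝ) ≤ 18 * ℓ + 1 ∧ (⌈5 * Real.sqrt 3 * (2 * ℓ) + ℓ⌉₊ : ℝ) ≤ 19 * ℓ + 1 := by
  have hs := sqrt_three_le
  have hs0 : 0 ≤ Real.sqrt 3 := Real.sqrt_nonneg _
  have h1 : 5 * Real.sqrt 3 * (2 * ℓ) ≤ 18 * ℓ := by nlinarith
  have h0 : 0 ≤ 5 * Real.sqrt 3 * (2 * ℓ) := by positivity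
  constructor
  · have := Nat.ceil_lt_add_one h0; linarith
  · have := Nat.ceil_lt_add_one (show 0 ≤ 5 * Real.sqrt 3 * (2 * ℓ) + ℓ by positivity); linarith

/-- the annulus count `(2(⌈10√3ℓ⌉₊+1))³ ≤ (40ℓ)³` (`ℓ ≥ 1`). [folklore] -/
theorem card_pow_le {ℓ : ℝ} (hℓ : 1 ≤ ℓ) :
    (((2 * (⌈5 * Real.sqrt 3 * (2 * ℓ)⌉₊ + 1)) ^ 3 : ℕ) : ℝ) ≤ (40 * ℓ) ^ 3 := by
  have h := (ceil_radius_le (by linarith : (0:ℝ) ≤ ℓ)).1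
  push_cast
  have h2 : (2 : ℝ) * ((⌈5 * Real.sqrt 3 * (2 * ℓ)⌉₊ : ℝ) + 1) ≤ 40 * ℓ := by linarith
  exact pow_le_pow_left₀ (by positivity) h2 3

/-- the bump-region count `(2(⌈10√3ℓ + ℓ⌉₊+1))³ ≤ (42ℓ)³` (`ℓ ≥ 1`). [folklore] -/
theorem card_pow_le' {ℓ : ℝ} (hℓ : 1 ≤ ℓ) :
    (((2 * (⌈5 * Real.sqrt 3 * (2 * ℓ) + ℓ⌉₊ + 1)) ^ 3 : ℕ) : ℝ) ≤ (42 * ℓ) ^ 3 := by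
  have h := (ceil_radius_le (by linarith : (0:ℝ) ≤ ℓ)).2
  push_cast
  have h2 : (2 : ℝ) * ((⌈5 * Real.sqrt 3 * (2 * ℓ) + ℓ⌉₊ : ℝ) + 1) ≤ 42 * ℓ := by linarith
  exact pow_le_pow_left₀ (by positivity) h2 3

/-- **THE WEIGHT COUNT** `W = √((2(1 + (4κ∕(π√3ℓ))⁻¹))³) ≤ √((2 + 9π∕(10κ))³)·(ℓ√ℓ)` (`ℓ ≥ 1`, `κ > 0`). [cite: Balaban1984PropagatorsII, (2.61) p.234] -/
theorem weight_count_le {ℓ κ : ℝ} (hℓ : 1 ≤ ℓ) (hκ : 0 < κ) :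
    Real.sqrt ((2 * (1 + 1 / (4 * κ / (Real.pi * Real.sqrt 3 * ℓ)))) ^ 3)
      ≤ Real.sqrt ((2 + 9 * Real.pi / (10 * κ)) ^ 3) * (ℓ * Real.sqrt ℓ) := by
  have hπ := Real.pi_pos
  have hs := sqrt_three_le
  have hs0 : 0 ≤ Real.sqrt 3 := Real.sqrt_nonneg _
  have hℓ0 : 0 ≤ ℓ := by linarith
  have hin0 : 0 ≤ 2 * (1 + 1 / (4 * κ / (Real.pi * Real.sqrt 3 * ℓ))) := by positivity
  have hw0 : 0 ≤ 2 + 9 * Real.pi / (10 * κ) := by positivity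
  -- the inner quantity is `≤ (2 + 9π/(10κ))·ℓ`
  have hinner : 2 * (1 + 1 / (4 * κ / (Real.pi * Real.sqrt 3 * ℓ))) ≤ (2 + 9 * Real.pi / (10 * κ)) * ℓ := by
    have e : 1 / (4 * κ / (Real.pi * Real.sqrt 3 * ℓ)) = Real.pi * Real.sqrt 3 * ℓ / (4 * κ) := by
      field_simp
    rw [e]
    have h1 : Real.pi * Real.sqrt 3 * ℓ / (4 * κ) ≤ 9 * Real.pi / (10 * κ) * ℓ / 2 := by
      rw [div_le_iff₀ (by positivity)]
      have : Real.pi * Real.sqrt 3 * ℓ ≤ Real.pi * (9 / 5) * ℓ := by nlinarith [mul_nonneg hπ.le hℓ0]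
      calc Real.pi * Real.sqrt 3 * ℓ ≤ Real.pi * (9 / 5) * ℓ := this
        _ = 9 * Real.pi / (10 * κ) * ℓ / 2 * (4 * κ) := by field_simp; ring
    nlinarith [mul_nonneg hπ.le hℓ0, h1]
  calc Real.sqrt ((2 * (1 + 1 / (4 * κ / (Real.pi * Real.sqrt 3 * ℓ)))) ^ 3)
      ≤ Real.sqrt (((2 + 9 * Real.pi / (10 * κ)) * ℓ) ^ 3) := Real.sqrt_le_sqrt (pow_le_pow_left₀ hin0 hinner 3)
    _ = Real.sqrt ((2 + 9 * Real.pi / (10 * κ)) ^ 3) * Real.sqrt (ℓ ^ 3) := by rw [mul_pow, Real.sqrt_mul (pow_nonneg hw0 3)]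
    _ = Real.sqrt ((2 + 9 * Real.pi / (10 * κ)) ^ 3) * (ℓ * Real.sqrt ℓ) := by rw [sqrt_cube hℓ0]

/-- `Ω = e^{κ(1 + (10√3ℓ+1)∕ℓ)} ≤ e^{20κ}` and `Ω_u = e^{κ(1 + (10√3ℓ+ℓ+1)∕ℓ)} ≤ e^{21κ}` (`ℓ ≥ 1`, `κ ≥ 0`). [folklore] -/
theorem exp_annulus_le {ℓ κ : ℝ} (hℓ : 1 ≤ ℓ) (hκ : 0 ≤ κ) :
    Real.exp (κ * (1 + (5 * Real.sqrt 3 * (2 * ℓ) + 1) / ℓ)) ≤ Real.exp (20 * κ)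
      ∧ Real.exp (κ * (1 + (5 * Real.sqrt 3 * (2 * ℓ) + ℓ + 1) / ℓ)) ≤ Real.exp (21 * κ) := by
  have hs := sqrt_three_le
  have hs0 : 0 ≤ Real.sqrt 3 := Real.sqrt_nonneg _
  have hℓ0 : 0 < ℓ := by linarith
  have h1 : (5 * Real.sqrt 3 * (2 * ℓ) + 1) / ℓ ≤ 19 := by
    rw [div_le_iff₀ hℓ0]; nlinarith
  have h2 : (5 * Real.sqrt 3 * (2 * ℓ) + ℓ + 1) / ℓ ≤ 20 := by
    rw [div_le_iff₀ hℓ0]; nlinarith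
  constructor
  · exact Real.exp_le_exp.mpr (by nlinarith)
  · exact Real.exp_le_exp.mpr (by nlinarith)

/-- `√(C_G∕c⁴) = √C_G∕c²` and `√(√(C_G∕c⁴)·ℓ²) = √(√C_G)·ℓ∕|c|` (`c ≠ 0`, `ℓ ≥ 0`, `C_G ≥ 0`). [folklore] -/
theorem sqrtA_eq {CG c ℓ : ℝ} (hCG : 0 ≤ CG) (hc : c ≠ 0) (hℓ : 0 ≤ ℓ) :
    Real.sqrt (CG / c ^ 4) = Real.sqrt CG / c ^ 2
      ∧ Real.sqrt (Real.sqrt (CG / c ^ 4) * ℓ ^ 2) = Real.sqrt (Real.sqrt CG) * ℓ / |c| := by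
  have hc2 : 0 < c ^ 2 := by positivity
  have h1 : Real.sqrt (CG / c ^ 4) = Real.sqrt CG / c ^ 2 := by
    rw [show c ^ 4 = (c ^ 2) ^ 2 by ring, Real.sqrt_div hCG, Real.sqrt_sq hc2.le]
  refine ⟨h1, ?_⟩
  rw [h1, Real.sqrt_mul (by positivity), Real.sqrt_sq hℓ, Real.sqrt_div (Real.sqrt_nonneg _), Real.sqrt_sq_eq_abs]
  ring

/-! ## §2 The pieces at scale ℓ -/

variable {ℓ c κ CR CN CH1 CH CV : ℝ}

/-- **WEIGHT × COUNT**: `W·√N ≤ √((R·(2+9π∕(10κ)))³)·ℓ³` whenever `N ≤ (Rℓ)³` (`R ≥ 0`, `ℓ ≥ 1`, `κ > 0`). [cite: Balaban1984PropagatorsII, (2.61) p.234] -/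
theorem weight_mul_sqrt_count_le (hℓ : 1 ≤ ℓ) (hκ : 0 < κ) {N R : ℝ} (hR : 0 ≤ R) (hN : N ≤ (R * ℓ) ^ 3) :
    Real.sqrt ((2 * (1 + 1 / (4 * κ / (Real.pi * Real.sqrt 3 * ℓ)))) ^ 3) * Real.sqrt N
      ≤ Real.sqrt ((R * (2 + 9 * Real.pi / (10 * κ))) ^ 3) * ℓ ^ 3 := by
  have hℓ0 : 0 ≤ ℓ := by linarith
  have hw := weight_count_le hℓ hκ
  have hw0 : 0 ≤ 2 + 9 * Real.pi / (10 * κ) := by positivity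
  have h1 : Real.sqrt N ≤ Real.sqrt ((R * ℓ) ^ 3) := Real.sqrt_le_sqrt hN
  have h2 : Real.sqrt ((R * ℓ) ^ 3) = Real.sqrt (R ^ 3) * (ℓ * Real.sqrt ℓ) := by
    rw [mul_pow, Real.sqrt_mul (pow_nonneg hR 3), sqrt_cube hℓ0]
  calc Real.sqrt ((2 * (1 + 1 / (4 * κ / (Real.pi * Real.sqrt 3 * ℓ)))) ^ 3) * Real.sqrt N
      ≤ (Real.sqrt ((2 + 9 * Real.pi / (10 * κ)) ^ 3) * (ℓ * Real.sqrt ℓ)) * (Real.sqrt (R ^ 3) * (ℓ * Real.sqrt ℓ)) := by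
        rw [← h2]; exact mul_le_mul hw h1 (Real.sqrt_nonneg _) (by positivity)
    _ = (Real.sqrt (R ^ 3) * Real.sqrt ((2 + 9 * Real.pi / (10 * κ)) ^ 3)) * (ℓ ^ 2 * (Real.sqrt ℓ * Real.sqrt ℓ)) := by ring
    _ = Real.sqrt ((R * (2 + 9 * Real.pi / (10 * κ))) ^ 3) * ℓ ^ 3 := by
        rw [Real.mul_self_sqrt hℓ0, ← Real.sqrt_mul (pow_nonneg hR 3), ← mul_pow]; ring

/-- the three `X`-pieces of (T1) at `d = 3`, `ℓ ≥ 3`, `c ≠ 0`:  `X₁ ≤ 3(C_H + C_V)∕(c²ℓ²)`, `X₂ ≤ 9C_N|c|∕(8c²ℓ³)`, `X₃ ≤ (243∕40)C_{H1}∕ℓ⁴`. [cite: Balaban1985RegularSpaces, (1.36) p.82] -/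
theorem pieces_le (hℓ : 3 ≤ ℓ) (hc : c ≠ 0) (hCN : 0 ≤ CN) (hCH1 : 0 ≤ CH1) (hCH : 0 ≤ CH) (hCV : 0 ≤ CV) :
    3 * (c ^ 2 * (3 / (2 * (2 * ℓ)) * (2 * (CH / (4 * c ^ 4) * Real.sqrt 3) / (2 * ℓ - 2)) + 9 / (2 * ℓ) ^ 2 * (CV / (4 * c ^ 4))))
        ≤ 3 * (CH + CV) / (c ^ 2 * ℓ ^ 2)
      ∧ 3 * (|(2 * c ^ 2)⁻¹| * CN) / (2 * ℓ - 2) ^ 2 * (|c| * (3 / (2 * (2 * ℓ)))) ≤ 9 * CN * |c| / (8 * (c ^ 2 * ℓ ^ 3))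
      ∧ 3 * (|c| * (3 / (2 * (2 * ℓ))) * (|c| * (3 * Real.sqrt 3 * (|(2 * c ^ 2)⁻¹| * CH1) / (2 * ℓ - 3) ^ 3))) ≤ 243 / 40 * CH1 / ℓ ^ 4 := by
  have hs := sqrt_three_le
  have hs0 : 0 ≤ Real.sqrt 3 := Real.sqrt_nonneg _
  have hℓ0 : 0 < ℓ := by linarith
  have hc2 : 0 < c ^ 2 := by positivity
  have hc4 : 0 < c ^ 4 := by positivity
  have hca : 0 < |c| := abs_pos.mpr hc
  have hinv : |(2 * c ^ 2)⁻¹| = 1 / (2 * c ^ 2) := by rw [abs_inv, abs_of_pos (by positivity), one_div]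
  have hℓ2 : ℓ ≤ 2 * ℓ - 2 := by linarith
  have hℓ3 : ℓ ≤ 2 * ℓ - 3 := by linarith
  have hℓ20 : 0 < 2 * ℓ - 2 := by linarith
  have hℓ30 : 0 < 2 * ℓ - 3 := by linarith
  refine ⟨?_, ?_, ?_⟩
  · -- X₁
    have h1 : 2 * (CH / (4 * c ^ 4) * Real.sqrt 3) / (2 * ℓ - 2) ≤ 2 * (CH / (4 * c ^ 4) * (9 / 5)) / ℓ := by
      have hn : 0 ≤ 2 * (CH / (4 * c ^ 4) * Real.sqrt 3) := by positivity
      calc 2 * (CH / (4 * c ^ 4) * Real.sqrt 3) / (2 * ℓ - 2) ≤ 2 * (CH / (4 * c ^ 4) * Real.sqrt 3) / ℓ :=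
            div_le_div_of_nonneg_left hn hℓ0 hℓ2
        _ ≤ 2 * (CH / (4 * c ^ 4) * (9 / 5)) / ℓ := by
            apply div_le_div_of_nonneg_right _ hℓ0.le
            have : CH / (4 * c ^ 4) * Real.sqrt 3 ≤ CH / (4 * c ^ 4) * (9 / 5) := mul_le_mul_of_nonneg_left hs (by positivity)
            linarith
    have h0a : 0 ≤ 3 / (2 * (2 * ℓ)) := by positivity
    have h2 : 3 / (2 * (2 * ℓ)) * (2 * (CH / (4 * c ^ 4) * Real.sqrt 3) / (2 * ℓ - 2)) ≤ 3 / (2 * (2 * ℓ)) * (2 * (CH / (4 * c ^ 4) * (9 / 5)) / ℓ) :=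
      mul_le_mul_of_nonneg_left h1 h0a
    have e : 3 * (c ^ 2 * (3 / (2 * (2 * ℓ)) * (2 * (CH / (4 * c ^ 4) * (9 / 5)) / ℓ) + 9 / (2 * ℓ) ^ 2 * (CV / (4 * c ^ 4))))
        = (81 / 40 * CH + 27 / 16 * CV) / (c ^ 2 * ℓ ^ 2) := by
      field_simp; ring
    calc 3 * (c ^ 2 * (3 / (2 * (2 * ℓ)) * (2 * (CH / (4 * c ^ 4) * Real.sqrt 3) / (2 * ℓ - 2)) + 9 / (2 * ℓ) ^ 2 * (CV / (4 * c ^ 4))))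
        ≤ 3 * (c ^ 2 * (3 / (2 * (2 * ℓ)) * (2 * (CH / (4 * c ^ 4) * (9 / 5)) / ℓ) + 9 / (2 * ℓ) ^ 2 * (CV / (4 * c ^ 4)))) := by
          nlinarith [mul_le_mul_of_nonneg_left h2 hc2.le]
      _ = (81 / 40 * CH + 27 / 16 * CV) / (c ^ 2 * ℓ ^ 2) := e
      _ ≤ 3 * (CH + CV) / (c ^ 2 * ℓ ^ 2) := by
          apply div_le_div_of_nonneg_right _ (by positivity); nlinarith
  · -- X₂
    rw [hinv]
    have h1 : 3 * (1 / (2 * c ^ 2) * CN) / (2 * ℓ - 2) ^ 2 ≤ 3 * (1 / (2 * c ^ 2) * CN) / ℓ ^ 2 :=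
      div_le_div_of_nonneg_left (by positivity) (by positivity) (pow_le_pow_left₀ hℓ0.le hℓ2 2)
    calc 3 * (1 / (2 * c ^ 2) * CN) / (2 * ℓ - 2) ^ 2 * (|c| * (3 / (2 * (2 * ℓ))))
        ≤ 3 * (1 / (2 * c ^ 2) * CN) / ℓ ^ 2 * (|c| * (3 / (2 * (2 * ℓ)))) := mul_le_mul_of_nonneg_right h1 (by positivity)
      _ = 9 * CN * |c| / (8 * (c ^ 2 * ℓ ^ 3)) := by field_simp; ring
  · -- X₃
    rw [hinv]
    have h1 : 3 * Real.sqrt 3 * (1 / (2 * c ^ 2) * CH1) / (2 * ℓ - 3) ^ 3 ≤ 3 * (9 / 5) * (1 / (2 * c ^ 2) * CH1) / ℓ ^ 3 := by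
      calc 3 * Real.sqrt 3 * (1 / (2 * c ^ 2) * CH1) / (2 * ℓ - 3) ^ 3 ≤ 3 * Real.sqrt 3 * (1 / (2 * c ^ 2) * CH1) / ℓ ^ 3 :=
            div_le_div_of_nonneg_left (by positivity) (by positivity) (pow_le_pow_left₀ hℓ0.le hℓ3 3)
        _ ≤ 3 * (9 / 5) * (1 / (2 * c ^ 2) * CH1) / ℓ ^ 3 := by
            apply div_le_div_of_nonneg_right _ (by positivity)
            have : 0 ≤ 1 / (2 * c ^ 2) * CH1 := by positivity
            nlinarith
    have habs : |c| * |c| = c ^ 2 := by rw [← sq, sq_abs]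
    calc 3 * (|c| * (3 / (2 * (2 * ℓ))) * (|c| * (3 * Real.sqrt 3 * (1 / (2 * c ^ 2) * CH1) / (2 * ℓ - 3) ^ 3)))
        ≤ 3 * (|c| * (3 / (2 * (2 * ℓ))) * (|c| * (3 * (9 / 5) * (1 / (2 * c ^ 2) * CH1) / ℓ ^ 3))) := by
          have h0 : 0 ≤ 3 * (|c| * (3 / (2 * (2 * ℓ)))) * |c| := by positivity
          nlinarith [mul_le_mul_of_nonneg_left h1 h0]
      _ = 243 / 40 * CH1 / ℓ ^ 4 * (|c| * |c| / c ^ 2) := by field_simp; ring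
      _ = 243 / 40 * CH1 / ℓ ^ 4 := by rw [habs, div_self hc2.ne', mul_one]

/-- the near-datum pieces: `D₀·B ≤ 4719·C_V∕(c²ℓ²)` (`B = 39c²(10√3+4)²∕ℓ²`, `10√3 + 4 ≤ 22`) and the near-field count `|(2c²)⁻¹|·C_R·(⌈10√3ℓ⌉₊+1) ≤ 10C_Rℓ∕c²`.
[cite: Balaban1985RegularSpaces, (1.36) p.82] -/
theorem pieces_le' (hℓ : 3 ≤ ℓ) (hc : c ≠ 0) (hCR : 0 ≤ CR) (hCV : 0 ≤ CV) :
    CV / (4 * c ^ 4) * (13 * (3 : ℝ) * c ^ 2 * (10 * Real.sqrt 3 + 4) ^ 2 / ℓ ^ 2) ≤ 4719 * CV / (c ^ 2 * ℓ ^ 2)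
      ∧ |(2 * c ^ 2)⁻¹| * (CR * ((⌈5 * Real.sqrt 3 * (2 * ℓ)⌉₊ : ℝ) + 1)) ≤ 10 * CR * ℓ / c ^ 2 := by
  have hs := sqrt_three_le
  have hs0 : 0 ≤ Real.sqrt 3 := Real.sqrt_nonneg _
  have hℓ0 : 0 < ℓ := by linarith
  have hc2 : 0 < c ^ 2 := by positivity
  have hinv : |(2 * c ^ 2)⁻¹| = 1 / (2 * c ^ 2) := by rw [abs_inv, abs_of_pos (by positivity), one_div]
  constructor
  · have h22 : (10 * Real.sqrt 3 + 4) ^ 2 ≤ 22 ^ 2 := pow_le_pow_left₀ (by positivity) (by linarith) 2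
    have e : CV / (4 * c ^ 4) * (13 * (3 : ℝ) * c ^ 2 * 22 ^ 2 / ℓ ^ 2) = 4719 * CV / (c ^ 2 * ℓ ^ 2) := by
      field_simp; ring
    rw [← e]
    apply mul_le_mul_of_nonneg_left _ (by positivity)
    apply div_le_div_of_nonneg_right _ (by positivity)
    nlinarith [mul_nonneg (by norm_num : (0:ℝ) ≤ 13 * 3) hc2.le]
  · rw [hinv]
    have h := (ceil_radius_le hℓ0.le).1
    have h2 : (⌈5 * Real.sqrt 3 * (2 * ℓ)⌉₊ : ℝ) + 1 ≤ 20 * ℓ := by linarith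
    calc 1 / (2 * c ^ 2) * (CR * ((⌈5 * Real.sqrt 3 * (2 * ℓ)⌉₊ : ℝ) + 1)) ≤ 1 / (2 * c ^ 2) * (CR * (20 * ℓ)) :=
          mul_le_mul_of_nonneg_left (mul_le_mul_of_nonneg_left h2 hCR) (by positivity)
      _ = 10 * CR * ℓ / c ^ 2 := by field_simp; ring

/-! ## §3 ★★★ The whole right-hand side is linear in `ℓ` -/

set_option maxHeartbeats 400000 in
/-- ★★★ **THE SCALE READING**: at `d = 3`, `ℓ ≥ 3`, `c ≠ 0`, `0 < κ`, nonnegative constants, the right-hand side of ✓ `Prop7PinnedKernelL1Explicit.sum_abs_laplace_kernel_le_explicit`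
is at most `Φ₀·ℓ∕c²` with the explicit `Φ₀(κ, C_R, C_N, C_{H1}, C_H, C_V)` below (`a_κ := 2 + 9π∕(10κ)`): every term of the (A-door) is `≍ ℓ∕c²` — `(T1) = W·(3Nh + 5√A·Nht + 5A·Ns)`
with `W·√N_T ≤ √((40a_κ)³)ℓ³`, `Nh∕√N_T ≲ (C_H+C_V)∕(c²ℓ²)`, …; `N₂ ≤ (10C_R + 192000(C_H+C_V))ℓ∕c²`; `N₃ ≤ 74088·4719·C_V·ℓ∕c²`; `(T4) = W·3N₄ ≤ 14157e^{21κ}√((42a_κ)³)C_V·ℓ∕c²`.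
[cite: Balaban1985RegularSpaces, (1.36) p.82; Balaban1984PropagatorsII, (2.61) p.234] -/
theorem explicit_le_linear (d : ℕ) (hd : d = 3) (hℓ : 3 ≤ ℓ) (hc : c ≠ 0) (hκ : 0 < κ)
    (hCR : 0 ≤ CR) (hCN : 0 ≤ CN) (hCH1 : 0 ≤ CH1) (hCH : 0 ≤ CH) (hCV : 0 ≤ CV) :
    Real.sqrt ((2 * (1 + 1 / (4 * κ / (Real.pi * Real.sqrt d * ℓ)))) ^ d)
      * (3 * (Real.exp (κ * (1 + (5 * Real.sqrt d * (2 * ℓ) + 1) / ℓ))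
      * (d * (c ^ 2 * (3 / (2 * (2 * ℓ)) * (2 * (CH / (4 * c ^ 4) * Real.sqrt d) / (2 * ℓ - 2))
      + 9 / (2 * ℓ) ^ 2 * (CV / (4 * c ^ 4)))))
      * Real.sqrt ((2 * (⌈5 * Real.sqrt d * (2 * ℓ)⌉₊ + 1)) ^ d : ℕ))
      + 5 * Real.sqrt (Real.sqrt ((2197 * (24 * 289 * 24576 * 46116) : ℝ) / c ^ 4) * (ℓ) ^ 2)
      * (Real.exp (κ * (1 + (5 * Real.sqrt d * (2 * ℓ) + 1) / ℓ))
      * (d * (|(2 * c ^ 2)⁻¹| * CN) / (2 * ℓ - 2) ^ 2 * (|c| * (3 / (2 * (2 * ℓ)))))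
      * Real.sqrt (d * ((2 * (⌈5 * Real.sqrt d * (2 * ℓ)⌉₊ + 1)) ^ d : ℕ)))
      + 5 * (Real.sqrt ((2197 * (24 * 289 * 24576 * 46116) : ℝ) / c ^ 4) * (ℓ) ^ 2)
      * (Real.exp (κ * (1 + (5 * Real.sqrt d * (2 * ℓ) + 1) / ℓ))
      * (d * (|c| * (3 / (2 * (2 * ℓ))) * (|c| * (d * Real.sqrt d * (|(2 * c ^ 2)⁻¹| * CH1) / (2 * ℓ - 3) ^ 3))))
      * Real.sqrt ((2 * (⌈5 * Real.sqrt d * (2 * ℓ)⌉₊ + 1)) ^ d : ℕ)))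
      + (|(2 * c ^ 2)⁻¹| * (CR * ((⌈5 * Real.sqrt d * (2 * ℓ)⌉₊ : ℝ) + 1))
      + ((2 * (⌈5 * Real.sqrt d * (2 * ℓ)⌉₊ + 1)) ^ d : ℕ)
      * (d * (c ^ 2 * (3 / (2 * (2 * ℓ)) * (2 * (CH / (4 * c ^ 4) * Real.sqrt d) / (2 * ℓ - 2))
      + 9 / (2 * ℓ) ^ 2 * (CV / (4 * c ^ 4))))))
      + ((2 * (⌈5 * Real.sqrt d * (2 * ℓ) + ℓ⌉₊ + 1)) ^ d : ℕ)
      * (CV / (4 * c ^ 4) * (13 * d * c ^ 2 * (10 * Real.sqrt d + 4) ^ 2 / (ℓ) ^ 2))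
      + Real.sqrt ((2 * (1 + 1 / (4 * κ / (Real.pi * Real.sqrt d * ℓ)))) ^ d)
      * (3 * (Real.exp (κ * (1 + (5 * Real.sqrt d * (2 * ℓ) + ℓ + 1) / ℓ))
      * (CV / (4 * c ^ 4) * (13 * d * c ^ 2 * (10 * Real.sqrt d + 4) ^ 2 / (ℓ) ^ 2))
      * Real.sqrt ((2 * (⌈5 * Real.sqrt d * (2 * ℓ) + ℓ⌉₊ + 1)) ^ d : ℕ)))
      ≤ (9 * Real.exp (20 * κ) * Real.sqrt ((40 * (2 + 9 * Real.pi / (10 * κ))) ^ 3) * (CH + CV)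
          + 45 / 8 * Real.exp (20 * κ) * Real.sqrt ((60 * (2 + 9 * Real.pi / (10 * κ))) ^ 3) * Real.sqrt (Real.sqrt (2197 * (24 * 289 * 24576 * 46116))) * CN
          + 243 / 8 * Real.exp (20 * κ) * Real.sqrt ((40 * (2 + 9 * Real.pi / (10 * κ))) ^ 3) * Real.sqrt (2197 * (24 * 289 * 24576 * 46116)) * CH1
          + (10 * CR + 192000 * (CH + CV))
          + 74088 * 4719 * CV
          + 14157 * Real.exp (21 * κ) * Real.sqrt ((42 * (2 + 9 * Real.pi / (10 * κ))) ^ 3) * CV) * ℓ / c ^ 2 := by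
  subst hd
  simp only [Nat.cast_ofNat]
  -- letters
  have hℓ1 : 1 ≤ ℓ := by linarith
  have hℓ0 : 0 < ℓ := by linarith
  have hc2 : 0 < c ^ 2 := by positivity
  have hca : 0 < |c| := abs_pos.mpr hc
  have hs0 : 0 ≤ Real.sqrt 3 := Real.sqrt_nonneg _
  have hℓ20 : 0 < 2 * ℓ - 2 := by linarith
  have hℓ30 : 0 < 2 * ℓ - 3 := by linarith
  set CG : ℝ := (2197 * (24 * 289 * 24576 * 46116) : ℝ) with hCG
  have hCG0 : 0 ≤ CG := by rw [hCG]; norm_num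
  set aκ : ℝ := 2 + 9 * Real.pi / (10 * κ) with haκ
  have haκ0 : 0 ≤ aκ := by rw [haκ]; positivity
  -- the atoms
  set W := Real.sqrt ((2 * (1 + 1 / (4 * κ / (Real.pi * Real.sqrt 3 * ℓ)))) ^ 3) with hW
  set Ω := Real.exp (κ * (1 + (5 * Real.sqrt 3 * (2 * ℓ) + 1) / ℓ)) with hΩ
  set Ωu := Real.exp (κ * (1 + (5 * Real.sqrt 3 * (2 * ℓ) + ℓ + 1) / ℓ)) with hΩu
  set NT : ℝ := (((2 * (⌈5 * Real.sqrt 3 * (2 * ℓ)⌉₊ + 1)) ^ 3 : ℕ) : ℝ) with hNT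
  set NTu : ℝ := (((2 * (⌈5 * Real.sqrt 3 * (2 * ℓ) + ℓ⌉₊ + 1)) ^ 3 : ℕ) : ℝ) with hNTu
  set X₁ := 3 * (c ^ 2 * (3 / (2 * (2 * ℓ)) * (2 * (CH / (4 * c ^ 4) * Real.sqrt 3) / (2 * ℓ - 2)) + 9 / (2 * ℓ) ^ 2 * (CV / (4 * c ^ 4)))) with hX₁
  set X₂ := 3 * (|(2 * c ^ 2)⁻¹| * CN) / (2 * ℓ - 2) ^ 2 * (|c| * (3 / (2 * (2 * ℓ)))) with hX₂
  set X₃ := 3 * (|c| * (3 / (2 * (2 * ℓ))) * (|c| * (3 * Real.sqrt 3 * (|(2 * c ^ 2)⁻¹| * CH1) / (2 * ℓ - 3) ^ 3))) with hX₃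
  set sA := Real.sqrt (Real.sqrt (CG / c ^ 4) * ℓ ^ 2) with hsA
  set A := Real.sqrt (CG / c ^ 4) * ℓ ^ 2 with hA
  set DB := CV / (4 * c ^ 4) * (13 * (3 : ℝ) * c ^ 2 * (10 * Real.sqrt 3 + 4) ^ 2 / ℓ ^ 2) with hDB
  set NR := |(2 * c ^ 2)⁻¹| * (CR * ((⌈5 * Real.sqrt 3 * (2 * ℓ)⌉₊ : ℝ) + 1)) with hNR
  -- bounds on the atoms
  have hWN : W * Real.sqrt NT ≤ Real.sqrt ((40 * aκ) ^ 3) * ℓ ^ 3 :=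
    weight_mul_sqrt_count_le hℓ1 hκ (by norm_num) (card_pow_le hℓ1)
  have hWN3 : W * Real.sqrt (3 * NT) ≤ Real.sqrt ((60 * aκ) ^ 3) * ℓ ^ 3 := by
    refine weight_mul_sqrt_count_le hℓ1 hκ (by norm_num) ?_
    have := card_pow_le hℓ1
    nlinarith [pow_nonneg hℓ0.le 3]
  have hWNu : W * Real.sqrt NTu ≤ Real.sqrt ((42 * aκ) ^ 3) * ℓ ^ 3 :=
    weight_mul_sqrt_count_le hℓ1 hκ (by norm_num) (card_pow_le' hℓ1)
  obtain ⟨hΩ, hΩu'⟩ := exp_annulus_le hℓ1 hκ.le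
  obtain ⟨hx₁, hx₂, hx₃⟩ := pieces_le hℓ hc hCN hCH1 hCH hCV
  obtain ⟨hDB', hNR'⟩ := pieces_le' hℓ hc hCR hCV
  obtain ⟨hA', hsA'⟩ := sqrtA_eq hCG0 hc hℓ0.le
  have hNT' : NT ≤ (40 * ℓ) ^ 3 := card_pow_le hℓ1
  have hNTu' : NTu ≤ (42 * ℓ) ^ 3 := card_pow_le' hℓ1
  -- nonnegativity of the atoms
  have hW0 : 0 ≤ W := Real.sqrt_nonneg _
  have hΩ0 : 0 ≤ Ω := (Real.exp_pos _).le
  have hΩu0 : 0 ≤ Ωu := (Real.exp_pos _).le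
  have hX₁0 : 0 ≤ X₁ := by rw [hX₁]; positivity
  have hX₂0 : 0 ≤ X₂ := by rw [hX₂]; positivity
  have hX₃0 : 0 ≤ X₃ := by rw [hX₃]; positivity
  have hsA0 : 0 ≤ sA := Real.sqrt_nonneg _
  have hA0 : 0 ≤ A := by rw [hA]; positivity
  have hNT0 : 0 ≤ NT := by rw [hNT]; positivity
  have hNTu0 : 0 ≤ NTu := by rw [hNTu]; positivity
  have hDB0 : 0 ≤ DB := by rw [hDB]; positivity
  -- the four summands
  have hT1 : W * (3 * (Ω * X₁ * Real.sqrt NT) + 5 * sA * (Ω * X₂ * Real.sqrt (3 * NT)) + 5 * A * (Ω * X₃ * Real.sqrt NT))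
      ≤ (9 * Real.exp (20 * κ) * Real.sqrt ((40 * aκ) ^ 3) * (CH + CV)
          + 45 / 8 * Real.exp (20 * κ) * Real.sqrt ((60 * aκ) ^ 3) * Real.sqrt (Real.sqrt CG) * CN
          + 243 / 8 * Real.exp (20 * κ) * Real.sqrt ((40 * aκ) ^ 3) * Real.sqrt CG * CH1) * ℓ / c ^ 2 := by
    have e : W * (3 * (Ω * X₁ * Real.sqrt NT) + 5 * sA * (Ω * X₂ * Real.sqrt (3 * NT)) + 5 * A * (Ω * X₃ * Real.sqrt NT))
        = 3 * (Ω * (X₁ * (W * Real.sqrt NT))) + 5 * (sA * (Ω * (X₂ * (W * Real.sqrt (3 * NT))))) + 5 * (A * (Ω * (X₃ * (W * Real.sqrt NT)))) := by ring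
    rw [e]
    have t1 : 3 * (Ω * (X₁ * (W * Real.sqrt NT))) ≤ 3 * (Real.exp (20 * κ) * (3 * (CH + CV) / (c ^ 2 * ℓ ^ 2) * (Real.sqrt ((40 * aκ) ^ 3) * ℓ ^ 3))) := by
      refine mul_le_mul_of_nonneg_left (mul_le_mul hΩ (mul_le_mul hx₁ hWN (by positivity) (by positivity)) (by positivity) (by positivity)) (by norm_num)
    have t2 : 5 * (sA * (Ω * (X₂ * (W * Real.sqrt (3 * NT)))))
        ≤ 5 * ((Real.sqrt (Real.sqrt CG) * ℓ / |c|) * (Real.exp (20 * κ) * (9 * CN * |c| / (8 * (c ^ 2 * ℓ ^ 3)) * (Real.sqrt ((60 * aκ) ^ 3) * ℓ ^ 3)))) := by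
      rw [hsA, hA, hsA']
      refine mul_le_mul_of_nonneg_left (mul_le_mul_of_nonneg_left ?_ (by positivity)) (by norm_num)
      exact mul_le_mul hΩ (mul_le_mul hx₂ hWN3 (by positivity) (by positivity)) (by positivity) (by positivity)
    have t3 : 5 * (A * (Ω * (X₃ * (W * Real.sqrt NT))))
        ≤ 5 * ((Real.sqrt CG / c ^ 2 * ℓ ^ 2) * (Real.exp (20 * κ) * (243 / 40 * CH1 / ℓ ^ 4 * (Real.sqrt ((40 * aκ) ^ 3) * ℓ ^ 3)))) := by
      rw [hA, hA']
      refine mul_le_mul_of_nonneg_left (mul_le_mul_of_nonneg_left ?_ (by positivity)) (by norm_num)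
      exact mul_le_mul hΩ (mul_le_mul hx₃ hWN (by positivity) (by positivity)) (by positivity) (by positivity)
    have e1 : 3 * (Real.exp (20 * κ) * (3 * (CH + CV) / (c ^ 2 * ℓ ^ 2) * (Real.sqrt ((40 * aκ) ^ 3) * ℓ ^ 3)))
        = (9 * Real.exp (20 * κ) * Real.sqrt ((40 * aκ) ^ 3) * (CH + CV)) * ℓ / c ^ 2 := by
      field_simp; ring
    have e2 : 5 * ((Real.sqrt (Real.sqrt CG) * ℓ / |c|) * (Real.exp (20 * κ) * (9 * CN * |c| / (8 * (c ^ 2 * ℓ ^ 3)) * (Real.sqrt ((60 * aκ) ^ 3) * ℓ ^ 3))))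
        = (45 / 8 * Real.exp (20 * κ) * Real.sqrt ((60 * aκ) ^ 3) * Real.sqrt (Real.sqrt CG) * CN) * ℓ / c ^ 2 := by
      field_simp; ring
    have e3 : 5 * ((Real.sqrt CG / c ^ 2 * ℓ ^ 2) * (Real.exp (20 * κ) * (243 / 40 * CH1 / ℓ ^ 4 * (Real.sqrt ((40 * aκ) ^ 3) * ℓ ^ 3))))
        = (243 / 8 * Real.exp (20 * κ) * Real.sqrt ((40 * aκ) ^ 3) * Real.sqrt CG * CH1) * ℓ / c ^ 2 := by
      field_simp; ring
    rw [e1] at t1; rw [e2] at t2; rw [e3] at t3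
    have esum : (9 * Real.exp (20 * κ) * Real.sqrt ((40 * aκ) ^ 3) * (CH + CV)
          + 45 / 8 * Real.exp (20 * κ) * Real.sqrt ((60 * aκ) ^ 3) * Real.sqrt (Real.sqrt CG) * CN
          + 243 / 8 * Real.exp (20 * κ) * Real.sqrt ((40 * aκ) ^ 3) * Real.sqrt CG * CH1) * ℓ / c ^ 2
        = (9 * Real.exp (20 * κ) * Real.sqrt ((40 * aκ) ^ 3) * (CH + CV)) * ℓ / c ^ 2
          + (45 / 8 * Real.exp (20 * κ) * Real.sqrt ((60 * aκ) ^ 3) * Real.sqrt (Real.sqrt CG) * CN) * ℓ / c ^ 2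
          + (243 / 8 * Real.exp (20 * κ) * Real.sqrt ((40 * aκ) ^ 3) * Real.sqrt CG * CH1) * ℓ / c ^ 2 := by ring
    rw [esum]
    exact add_le_add (add_le_add t1 t2) t3
  have hN2 : NR + NT * X₁ ≤ (10 * CR + 192000 * (CH + CV)) * ℓ / c ^ 2 := by
    have t : NT * X₁ ≤ (40 * ℓ) ^ 3 * (3 * (CH + CV) / (c ^ 2 * ℓ ^ 2)) := mul_le_mul hNT' hx₁ hX₁0 (by positivity)
    have e : (40 * ℓ) ^ 3 * (3 * (CH + CV) / (c ^ 2 * ℓ ^ 2)) = 192000 * (CH + CV) * ℓ / c ^ 2 := by field_simp; ring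
    rw [e] at t
    have e2 : (10 * CR + 192000 * (CH + CV)) * ℓ / c ^ 2 = 10 * CR * ℓ / c ^ 2 + 192000 * (CH + CV) * ℓ / c ^ 2 := by ring
    rw [e2]
    exact add_le_add hNR' t
  have hN3 : NTu * DB ≤ 74088 * 4719 * CV * ℓ / c ^ 2 := by
    have t : NTu * DB ≤ (42 * ℓ) ^ 3 * (4719 * CV / (c ^ 2 * ℓ ^ 2)) := mul_le_mul hNTu' hDB' hDB0 (by positivity)
    have e : (42 * ℓ) ^ 3 * (4719 * CV / (c ^ 2 * ℓ ^ 2)) = 74088 * 4719 * CV * ℓ / c ^ 2 := by field_simp; ring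
    rw [e] at t; exact t
  have hT4 : W * (3 * (Ωu * DB * Real.sqrt NTu)) ≤ 14157 * Real.exp (21 * κ) * Real.sqrt ((42 * aκ) ^ 3) * CV * ℓ / c ^ 2 := by
    have e : W * (3 * (Ωu * DB * Real.sqrt NTu)) = 3 * (Ωu * (DB * (W * Real.sqrt NTu))) := by ring
    rw [e]
    have t : 3 * (Ωu * (DB * (W * Real.sqrt NTu))) ≤ 3 * (Real.exp (21 * κ) * (4719 * CV / (c ^ 2 * ℓ ^ 2) * (Real.sqrt ((42 * aκ) ^ 3) * ℓ ^ 3))) := by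
      refine mul_le_mul_of_nonneg_left (mul_le_mul hΩu' (mul_le_mul hDB' hWNu (by positivity) (by positivity)) (by positivity) (by positivity)) (by norm_num)
    have e2 : 3 * (Real.exp (21 * κ) * (4719 * CV / (c ^ 2 * ℓ ^ 2) * (Real.sqrt ((42 * aκ) ^ 3) * ℓ ^ 3)))
        = 14157 * Real.exp (21 * κ) * Real.sqrt ((42 * aκ) ^ 3) * CV * ℓ / c ^ 2 := by field_simp; ring
    rw [e2] at t; exact t
  -- sum
  have etot : (9 * Real.exp (20 * κ) * Real.sqrt ((40 * aκ) ^ 3) * (CH + CV)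
          + 45 / 8 * Real.exp (20 * κ) * Real.sqrt ((60 * aκ) ^ 3) * Real.sqrt (Real.sqrt CG) * CN
          + 243 / 8 * Real.exp (20 * κ) * Real.sqrt ((40 * aκ) ^ 3) * Real.sqrt CG * CH1
          + (10 * CR + 192000 * (CH + CV))
          + 74088 * 4719 * CV
          + 14157 * Real.exp (21 * κ) * Real.sqrt ((42 * aκ) ^ 3) * CV) * ℓ / c ^ 2
      = (9 * Real.exp (20 * κ) * Real.sqrt ((40 * aκ) ^ 3) * (CH + CV)
          + 45 / 8 * Real.exp (20 * κ) * Real.sqrt ((60 * aκ) ^ 3) * Real.sqrt (Real.sqrt CG) * CN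
          + 243 / 8 * Real.exp (20 * κ) * Real.sqrt ((40 * aκ) ^ 3) * Real.sqrt CG * CH1) * ℓ / c ^ 2
        + (10 * CR + 192000 * (CH + CV)) * ℓ / c ^ 2
        + 74088 * 4719 * CV * ℓ / c ^ 2
        + 14157 * Real.exp (21 * κ) * Real.sqrt ((42 * aκ) ^ 3) * CV * ℓ / c ^ 2 := by ring
  rw [etot]
  exact add_le_add (add_le_add (add_le_add hT1 hN2) hN3) hT4

end Summit.QuantumFields.YangMills.Theorems.Prop7PinnedKernelL1Arith

end
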